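import Summits.QuantumFields.YangMills.Theses.MirrorModularBoosts

/-!
# Sketch — crux-ideate stmt-QuantumFields-9663 (CurvatureBoostCovariance), ideator 1

First lemmas of the idea cards (they only need to ELABORATE; no proofs here).
-/

namespace Summit.QuantumFields.YangMills.Cruxes.CurvatureBoostCovariance.BoostInheritedMirrorSieve

open Literature.MathematicalPhysics.QuantumLattice Literature.MathematicalPhysics.AQFT
  Literature.MathematicalPhysics.QuantumFieldTheory
open Filter Topology MeasureTheory

/-- **First lemma of card `boost-inherited-mirror-sieve` (n = 2 harmonic sieve, model-blind).**
A translation-invariant one-species Schwinger family on `ℝ⁴`, symmetric (E3), with linear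
growth (E0'), invariant under the proper signed permutations, reflection positive in the eight
planar frames of the `(x₀,x₁)`-plane AND carrying the planar spectral cone in each of those
eight frames (for the diagonal frames this is `PlanarSpectralCone` applied to the pulled-back
family), whose two-point function is a continuous kernel `K` off the origin with the
ASYMPTOTIC-FREEDOM SOFTENING `t_j⁸ ‖K(t_j e₀)‖ → 0` along some `t_j → 0⁺`, has a two-point
function invariant under every rotation of the `(x₀,x₁)`-plane.
Mechanism: complex rotations `R_{iχ}` are boosts of each axis-frame reconstruction (cone), so
`S ∘ R_{iχ}` stays RP in all eight frames; the angular Fourier components `C_k` (`k ∈ 4ℤ`) of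
`S₂` are capped at `|k| ≤ 8` by temperedness, `k = ±8` dies by the softening, and `k = ±4` is
the top ODD layer of the Laurent pencil `Σ sᵐ B_{4m} ≥ 0 (s ∈ ℝ∖0)` hence vanishes. -/
def TwoPointSieve : Prop :=
  let E := EuclideanSpace ℝ (Fin 4)
  let e : Fin 4 → E := fun i => EuclideanSpace.single i 1
  -- the planar spectral cone of a family `T` along `e 0` (verbatim the conclusion of
  -- `MirrorModularBoosts.PlanarSpectralCone`)
  let Cone := fun (T : SchwingerFamily E) =>
    ∀ (n m : ℕ) (F : SchwartzMap (Fin n → E) ℂ) (G : SchwartzMap (Fin m → E) ℂ),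
      IsTimeOrdered F → IsTimeOrdered G →
        ∃ Φ : ℂ × ℂ → ℂ, DifferentiableOn ℂ Φ {w : ℂ × ℂ | |w.2.im| < w.1.re} ∧
          (∀ (t b : ℝ), 0 < t → ∀ H : SchwartzMap (Fin (n + m) → E) ℂ,
            IsAppendTensorOf H (osAdjoint F) (translateMulti (t • e 0 + b • e 1) G) →
              Φ ((t : ℂ), (b : ℂ)) = T (n + m) H) ∧
          (∀ w ∈ {w : ℂ × ℂ | |w.2.im| < w.1.re},
            ∀ (HF : SchwartzMap (Fin (n + n) → E) ℂ) (HG : SchwartzMap (Fin (m + m) → E) ℂ),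
              IsAppendTensorOf HF (osAdjoint F) F → IsAppendTensorOf HG (osAdjoint G) G →
                ‖Φ w‖ ^ 2 ≤ ‖T (n + n) HF‖ * ‖T (m + m) HG‖)
  ∀ (S : SchwingerFamily E),
    S.toLabelled.HasLinearGrowth → S.toLabelled.IsSymmetric →
    -- translations on ⁰𝒮
    (∀ (n : ℕ) (a : E) (F : SchwartzMap (Fin n → E) ℂ), IsOffDiagonal F →
      S n (translateMulti a F) = S n F) →
    -- proper signed permutations on ⁰𝒮
    (∀ (R : E ≃ₗᵢ[ℝ] E), LinearMap.det (R.toLinearEquiv : E →ₗ[ℝ] E) = 1 →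
      (∀ i : Fin 4, ∃ j : Fin 4, R (e i) = e j ∨ R (e i) = -e j) →
        ∀ (n : ℕ) (F : SchwartzMap (Fin n → E) ℂ), IsOffDiagonal F →
          S n (linActMulti R F) = S n F) →
    -- reflection positivity AND the planar cone in the eight planar frames
    (∀ (R : E ≃ₗᵢ[ℝ] E) (a b : ℝ), a ^ 2 + b ^ 2 = 1 → (a = 0 ∨ b = 0 ∨ a ^ 2 = b ^ 2) →
      R (e 0) = a • e 0 + b • e 1 →
        (SchwingerFamily.toLabelled (fun n => (S n).comp (linActMulti R))).IsReflectionPositive ∧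
          Cone (fun n => (S n).comp (linActMulti R))) →
    -- two-point kernel off the origin with asymptotic-freedom softening along e 0
    (∃ K : E → ℂ, ContinuousOn K {x : E | x ≠ 0} ∧
      (∀ (f g : SchwartzMap E ℂ) (F : SchwartzMap (Fin 2 → E) ℂ), IsTensorOf F ![f, g] →
        IsOffDiagonal F → S 2 F = ∫ x, ∫ y, f x * g y * K (y - x)) ∧
      ∃ t : ℕ → ℝ, (∀ j, 0 < t j) ∧ Tendsto t atTop (𝓝 0) ∧
        Tendsto (fun j => t j ^ 8 * ‖K (t j • e 0)‖) atTop (𝓝 0)) →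
    -- conclusion: planar rotation invariance of the two-point function on ⁰𝒮
    ∀ (R : E ≃ₗᵢ[ℝ] E), LinearMap.det (R.toLinearEquiv : E →ₗ[ℝ] E) = 1 →
      R (e 2) = e 2 → R (e 3) = e 3 →
        ∀ F : SchwartzMap (Fin 2 → E) ℂ, IsOffDiagonal F → S 2 (linActMulti R F) = S 2 F

/-- **Boost inheritance of mirror positivity, harmonic form (the lever itself, model-blind).**
For a family as above, every angular Fourier component
`C_k n F := (2π)⁻¹ ∫₀^{2π} e^{-ikθ} S n (linActMulti R_θ⁻¹ F) dθ` of ODD index `k/4`, if it is the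
top non-vanishing component in degree `2`, has vanishing OS pairings in frame `e 0`.
Stated here for the two-point function with the rotation `R_θ` of the `(x₀,x₁)`-plane supplied
as a hypothesis-parametrised isometry (we only assume what we use: `rot θ` fixes `e 2, e 3`,
has determinant one, `rot 0 = refl`, and `θ ↦ S 2 (linActMulti (rot θ) F)` is continuous). -/
def OddTopHarmonicVanishes : Prop :=
  let E := EuclideanSpace ℝ (Fin 4)
  let e : Fin 4 → E := fun i => EuclideanSpace.single i 1
  ∀ (S : SchwingerFamily E) (rot : ℝ → (E ≃ₗᵢ[ℝ] E)),
    (∀ θ, LinearMap.det ((rot θ).toLinearEquiv : E →ₗ[ℝ] E) = 1 ∧ rot θ (e 2) = e 2 ∧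
      rot θ (e 3) = e 3 ∧ rot θ (e 0) = Real.cos θ • e 0 + Real.sin θ • e 1) →
    (∀ F : SchwartzMap (Fin 2 → E) ℂ, Continuous fun θ => S 2 (linActMulti (rot θ) F)) →
    let C : ℤ → SchwartzMap (Fin 2 → E) ℂ → ℂ := fun k F =>
      (2 * Real.pi)⁻¹ * ∫ θ in Set.Icc (0 : ℝ) (2 * Real.pi),
        Complex.exp (-(k : ℂ) * θ * Complex.I) * S 2 (linActMulti (rot θ) F)
    ∀ M : ℤ, Odd M →
      -- `4M` is the top harmonic of `S 2` …
      (∀ k : ℤ, 4 * M < |k| → ∀ F, IsOffDiagonal F → C k F = 0) →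
      -- … and the Laurent pencil of OS pairings is non-negative on both half-lines
      -- (axis frames give `s > 0`, diagonal frames give `s < 0`):
      (∀ (s : ℝ), s ≠ 0 → ∀ (f : SchwartzMap (Fin 1 → E) ℂ), IsTimeOrdered f →
        ∀ H : SchwartzMap (Fin (1 + 1) → E) ℂ, IsAppendTensorOf H (osAdjoint f) f →
          0 ≤ (∑ m ∈ Finset.Icc (-|M|) |M|, (s : ℂ) ^ m * C (4 * m) H).re ∧
            (∑ m ∈ Finset.Icc (-|M|) |M|, (s : ℂ) ^ m * C (4 * m) H).im = 0) →
      ∀ (f g : SchwartzMap (Fin 1 → E) ℂ), IsTimeOrdered f → IsTimeOrdered g →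
        ∀ H : SchwartzMap (Fin (1 + 1) → E) ℂ, IsAppendTensorOf H (osAdjoint f) g →
          C (4 * M) H = 0 ∧ C (-(4 * M)) H = 0

end Summit.QuantumFields.YangMills.Cruxes.CurvatureBoostCovariance.BoostInheritedMirrorSieve
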